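import Summits.BirchSwinnertonDyer.Rank1Residual.Additive.X4RankZeroLowerCertificate
import Summits.BirchSwinnertonDyer.Rank1Residual.Additive.X4RankZeroKatoParity
import HarnessLib

/-!
# X4 ∧ `r_an = 0`, every odd `p`: the LOWER residue in the OUTPUT SHAPE of Kim's Kurihara-number
# theorems — `L(E,1)/Ω = q₀ ∧ ord_p q₀ − j ≤ ord_p #Ш(p)` (`j ≤ ord_p ∏ c_ℓ`) ⟹ `BSD(E,p)`
# (cell `b2b-bsdres`, seat additive-p4 gen 16, line V27; CLASS-CLOSURE §3.1 N11 / §3.2 N10 socket)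

HONEST FRAMING (cell `b2b-bsdres`, run/shared/lean/b2b/bsd-rank1-residual/, verbatim in every
file): the goal of the cell is to DELETE the COMBINATION-SHAPED residual classes of the
Birch–Swinnerton-Dyer formula for ALL analytic-rank `≤ 1` elliptic curves over `ℚ` — "full BSD
formula for every rank `≤ 1` curve in class `C`" assembled STRICTLY from published theorems — so
that the rank-`≤ 1` remainder becomes exactly the CONSTRUCTION-SHAPED classes, which are TYPED
(missing-input `Prop`s), NOT attempted. This is not "finishing BSD". Sub-cell additive-p4 (X3♯/X4♯
direct): research route on the CONSTRUCTION-SHAPED class X4; PER-PAIR consumers in the vocabulary of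
the chain of record, not a class theorem; the label X4 is UNCHANGED; nothing is booked by this file.
Theorems only (no definition, no named fact minted; every published input is an explicit named-fact
hypothesis; NO Kurihara-number theorem is assumed here — see "What this file is NOT").

## Why (CLASS-CLOSURE-PLAN §3.1 N11 / §3.2 N10, additive-p4 INPUT 2026-08-21)

Gen 14's end state `x4SharpUnitFree_iff_lower_and_residues_sharp` leaves on X4 ∧ `r_an = 0` ∧
surj(p) the LOWER residue (`p ∣ #Ш_an`: window 74 rows at `p = 3`, 11 at `p = 5`; sweep 7 394 /
1 167), and gen 15 (`Additive/X4RankZeroLowerCertificate.lean`) closed it per pair by a DESCENT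
certificate (`p^{2k−1} ∣ #Ш` / `Sel^(p)(E/ℚ) ≠ 0`). The OTHER per-pair instrument is a KURIHARA
NUMBER: C.-H. Kim, *Amer. J. Math.* 148 (2026) Thm. 1.8 (= arXiv:2203.12159v4 Thm. 1.9), third
clause, in analytic rank `0` reads `length_{ℤ_p} Ш(E/ℚ)[p^∞] = ∂^{(0)}(δ̃) − ∂^{(∞)}(δ̃)` with
`∂^{(0)} = ord_p(L(E,1)/Ω_E)` and `∂^{(∞)} = min_{n ∈ 𝒩₁} ord(δ̃_n)` (§1.5.1, PDF p. 7) — so ONE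
Kolyvagin level `n` with `ord(δ̃_n) = j` gives `ord_p #Ш[p^∞] ≥ ord_p(L(E,1)/Ω_E) − j`
(`p ≥ 5`, `ρ̄` onto, Manin constant prime to `p`, ANY reduction at `p`; tree facts
`Kim2022_rankZero_padicValRat_sha_of_kuriharaNumber_ne_zero_of_maninConstant` (unit case, harvest-2)
and the general-valuation form being typed by team n1011 (OWNERS T-N10K); the `p = 3` case is
ANNOUNCED — Kim, arXiv:2505.09121 (2025) Thm. 1.1 / Cor. 1.7, `p ≥ 3`, large image — and is being
typed as an OPEN hypothesis by team n1011 (OWNERS T-a4); NEITHER is assumed in this file).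

THIS FILE is the fact-agnostic SOCKET between those theorems' common OUTPUT SHAPE at a pair,
  `∃ q₀ : ℚ, L(E,1)/Ω(W) = q₀ ∧ ord_p q₀ − j ≤ ord_p #Ш(E/ℚ)(p)` with `j ≤ ord_p ∏_ℓ c_ℓ`,
and the residue partition of record:

* §1 `missingLowerBoundAt_of_rankZero_of_LOmegaWitness` (class-free bookkeeping): in analytic rank
  `0`, with `rank = r_an` and `Ш` finite (GZK) and `E[p]` irreducible (`p ∤ #E(ℚ)_tors`), the output
  shape gives the LOWER half `ord_p #Ш_an ≤ ord_p #Ш` (`Typed.MissingLowerBoundAt W p`), because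
  `#Ш_an = q₀ · #tors² / ∏ c_ℓ` (same computation as additive-p3's
  `X4.bsdp_iff_not_dvd_tamagawaProduct_of_rankZero_witness`, here as an inequality).
* §2 `X4RankZero.bsdp_of_facts_of_LOmegaWitness`: on the covered locus of X4 ∧ `r_an = 0` ∧ surj(p)
  [`ord_p j < 0` ∨ (tower ∧ `ord_p ∏ c_ℓ = ord_p c_p` ∧ Manin datum)] the output shape ⟹ `BSD(E,p)`
  (`X4RankZero.bsdp_of_facts_of_lower`); census shapes `…_of_five_le`, and at `p = 3`
  `X4RankZero.bsdp_three_of_towerSurj_of_optimal_of_LOmegaWitness` (kernel-certificate form of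
  `Additive/X4ThreeResCertKernel.lean`) and `X4RankZero.bsdp_three_potMult_of_LOmegaWitness`.
* §3 `X4RankZero.bsdp_of_katoSharp_of_casselsTate_of_LOmegaWitness_of_even`: the Tamagawa-defect-ONE
  LOWER rows (`ord_p ∏ c_ℓ ≤ v_p(c_p) + 1`, `ord_p #Ш_an` even — window: 5 rows at `p = 3`): sharp
  Kato upper bound + Cassels–Tate parity (`X4RankZero.even_padicValNat_shaOrder_and_le_of_katoSharp`)
  + the output shape ⟹ `BSD(E,p)`; `p = 3` certificate form
  `X4RankZero.bsdp_three_of_towerSurj_of_optimal_of_LOmegaWitness_of_even`.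

So the day a Kurihara-number theorem (published at `p ≥ 5`; announced at `p = 3`) delivers the output
shape at a pair, that LOWER row is `BSD(E,p)` by composition with this file — 69 of the 74 window
LOWER rows at `3` through §2 (unit-shaped: `j = 0`), 5 through §3 (`j = 1`).

WHAT THIS FILE IS NOT: it asserts NO Kurihara-number theorem (none is a hypothesis here), types no
conjecture, closes no class; X4 stays CONSTRUCTION-SHAPED; nothing is booked.

References: Kim 2026 [Kim2022StructureSelmer] Thm. 1.8 (6), §1.5.1, Conj. 1.9 (journal numbering);
Kim 2025 arXiv:2505.09121 Thm. 1.1 / Cor. 1.7 (PRE; context only); Kato 2004 [Kato2004Asterisque]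
Thm. 14.5 (3), Prop. 14.16 (2); Delbourgo 1998 [Delbourgo1998] Prop. 4; Silverman *AEC*
[SilvermanAEC2009] Thm. X.4.14 (Cassels–Tate); Miller 2011 [Miller2011LMS] Def. 1.1;
Agashe–Ribet–Stein 2006 [AgasheRibetStein2006] Thm. 2.6.
-/

noncomputable section

open scoped Classical

open WeierstrassCurve Literature.NumberTheory.EllipticCurves
  Literature.NumberTheory.EllipticCurves.ModularForms
  Literature.NumberTheory.EllipticCurves.Rank1Residual
  Literature.NumberTheory.EllipticCurves.Rank1Residual.Typed
  Literature.NumberTheory.EllipticCurves.AgasheRibetStein2006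

namespace Summit.BirchSwinnertonDyer.Rank1Residual.Additive

variable (W : WeierstrassCurve ℚ) [W.IsElliptic] [W.IsGloballyMinimal] (p : ℕ) [hp : Fact p.Prime]

/-! ### §1 Class-free bookkeeping: the output shape gives the LOWER half in analytic rank `0` -/

omit [W.IsGloballyMinimal] in
/-- **The LOWER half from the output shape of a Kurihara-number theorem (class-free).** In analytic
rank `0` (modularity `hmod` reads `r_an = 0` as `L(E,1) ≠ 0`), with `rank E(ℚ) = r_an` and `Ш(E/ℚ)`
finite (`hGZK`) and `E[p]` irreducible (so `p ∤ #E(ℚ)_tors`): if `L(E,1)/Ω(W) = q₀ ∈ ℚ` and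
`ord_p q₀ − j ≤ ord_p #Ш(E/ℚ)(p)` for some `j ≤ ord_p ∏_ℓ c_ℓ`, then `ord_p #Ш_an ≤ ord_p #Ш`
(`Typed.MissingLowerBoundAt W p`) — since `#Ш_an = q₀ · #E(ℚ)²_tors / ∏_ℓ c_ℓ` in rank `0`, i.e.
`ord_p #Ш_an = ord_p q₀ − ord_p ∏ c_ℓ ≤ ord_p q₀ − j`. Fact-free bookkeeping; the hypothesis is the
OUTPUT SHAPE of Kim 2026 Thm. 1.8 (6) at one Kolyvagin level of valuation `j` (not assumed here).
[cite: Miller2011LMS, Def. 1.1 (arXiv:1010.2431 p. 3)]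
[cite: Kim2022StructureSelmer, Thm. 1.8 (6) and §1.5.1 (journal; = v4 Thm. 1.9, PDF pp. 7–8)] -/
theorem missingLowerBoundAt_of_rankZero_of_LOmegaWitness
    (hGZK : rank_eq_analyticRank_of_analyticRank_le_one) (hmod : hasEntireLFunction_rat)
    (hr : W.analyticRank = 0) (hirr : W.HasIrreducibleModPGaloisRep p)
    {q₀ : ℚ} (hq₀ : W.entireLFunction 1 / (W.realPeriodRat : ℂ) = (q₀ : ℂ))
    {j : ℕ} (hj : j ≤ padicValNat p W.tamagawaProduct)
    (hw : padicValRat p q₀ - j ≤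
      (padicValNat p (Nat.card (AddCommGroup.primaryComponent W.sha p)) : ℤ)) :
    MissingLowerBoundAt W p := by
  have hL : W.entireLFunction 1 ≠ 0 := (W.analyticRank_eq_zero_iff_holds (hmod W)).mp hr
  obtain ⟨hmw, hfin⟩ := hGZK W (by rw [hr]; exact zero_le_one)
  haveI : Finite W.sha := hfin
  have hmw0 : W.mordellWeilRank = 0 := by rw [hmw, hr]
  have hΩpos : 0 < W.realPeriodRat := by
    haveI : (W.baseChange ℝ).IsElliptic := by rw [baseChange]; infer_instance
    exact (W.baseChange ℝ).realPeriod_pos'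
  have hΩ : (W.realPeriodRat : ℂ) ≠ 0 := by exact_mod_cast hΩpos.ne'
  rw [div_eq_iff hΩ] at hq₀
  have hq0 : q₀ ≠ 0 := by
    rintro rfl
    apply hL
    rw [hq₀]; simp
  have ht0 : (W.torsionOrder : ℚ) ≠ 0 := by exact_mod_cast (W.torsionOrder_pos_holds).ne'
  have hc0 : (W.tamagawaProduct : ℚ) ≠ 0 := by exact_mod_cast (W.tamagawaProduct_pos').ne'
  -- `#Ш_an = q₀ · #tors² / ∏ c` in analytic rank `0`
  have hsha : shaAn W = ((q₀ * (W.torsionOrder : ℚ) ^ 2 / (W.tamagawaProduct : ℚ) : ℚ) : ℂ) := by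
    have hR : W.regulator = 1 := W.regulator_eq_one_of_rank_zero hmw0
    have hc0' : (W.tamagawaProduct : ℂ) ≠ 0 := by exact_mod_cast (W.tamagawaProduct_pos').ne'
    rw [shaAn_def, WeierstrassCurve.leadingLCoeff, hr, iteratedDeriv_zero, Nat.factorial_zero,
      Nat.cast_one, div_one, hq₀, hR]
    push_cast
    field_simp
  -- its valuation: `ord_p q₀ − ord_p ∏ c` (the torsion is prime to `p`)
  have htors0 : padicValNat p W.torsionOrder = 0 :=
    padicValNat_torsionOrder_eq_zero_of_irreducible W p hirr
  have hvq : padicValRat p (q₀ * (W.torsionOrder : ℚ) ^ 2 / (W.tamagawaProduct : ℚ)) =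
      padicValRat p q₀ - padicValNat p W.tamagawaProduct := by
    have h2 : padicValRat p ((W.torsionOrder : ℚ) ^ 2) = 2 * padicValRat p (W.torsionOrder : ℚ) := by
      rw [pow_two, padicValRat.mul ht0 ht0]; ring
    rw [padicValRat.div (mul_ne_zero hq0 (pow_ne_zero 2 ht0)) hc0,
      padicValRat.mul hq0 (pow_ne_zero 2 ht0), h2, padicValRat.of_nat, padicValRat.of_nat, htors0]
    push_cast; ring
  -- `ord_p #Ш(p) = ord_p #Ш` for finite `Ш`
  have hcard : (padicValNat p (Nat.card (AddCommGroup.primaryComponent W.sha p)) : ℤ) =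
      padicValNat p W.shaOrder := by
    rw [WeierstrassCurve.shaOrder, padicValNat_card_addPrimaryComponent]
  refine ⟨_, hsha, ?_⟩
  rw [hvq]
  have hj' : (j : ℤ) ≤ padicValNat p W.tamagawaProduct := by exact_mod_cast hj
  linarith

/-! ### §2 X4 ∧ `r_an = 0`: the covered locus + the output shape ⟹ `BSD(E,p)` -/

/-- **X4 ∧ `r_an = 0`, covered locus: the output shape of a Kurihara-number theorem closes the pair.**
On [`ord_p j < 0` ∨ (`ρ̄_{E,p^n}` onto ∀ `n` ∧ `ord_p ∏ c_ℓ = ord_p c_p` ∧ a datum with `p ∤ c_D`)]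
of X4 ∧ `r_an = 0` ∧ surj(p), `L(E,1)/Ω(W) = q₀` with `ord_p q₀ − j ≤ ord_p #Ш(p)`, `j ≤ ord_p ∏ c_ℓ`
⟹ `BSD(E,p)`: §1 gives the LOWER half, the five named facts the UPPER half
(`X4RankZero.bsdp_of_facts_of_lower`). Per pair; NOT a class theorem; no Kurihara-number theorem is
assumed (its output is the hypothesis). [cite: Kato2004Asterisque, Thm. 14.5 (3) (p. 236)]
[cite: Delbourgo1998, Prop. 4 (p. 144)] [cite: Miller2011LMS, §1 and Def. 1.1]
[cite: Kim2022StructureSelmer, Thm. 1.8 (6) (journal)] -/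
theorem X4RankZero.bsdp_of_facts_of_LOmegaWitness
    (hKatoS : Kato2004.rankZero_padicValNat_sha_le_sub_localTamagawa_of_additive_potGood_of_imageContainsSL2)
    (hDel : Delbourgo1998.prop4_rankZero_pow_dvd_constantCoeff)
    (hGZK : rank_eq_analyticRank_of_analyticRank_le_one) (hmod : hasEntireLFunction_rat)
    (hmodD : nonempty_modularParametrizationData)
    (hL20 : Wuthrich2014.lemma20_surjective_threeAdic_of_semistable)
    (hKatoχ : Wuthrich2014.kato_halfEigenCharIdeal_dvd_cyclotomicPrime_of_surjective)
    (hr : W.analyticRank = 0) (hX : ClassX4 W p) (hsurj : Surj W p)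
    (hcov : padicValRat p W.j < 0 ∨
      ((∀ n : ℕ, W.HasSurjectiveModNGaloisRep (p ^ n : ℕ)) ∧
        padicValNat p W.tamagawaProduct =
          padicValNat p ((W.baseChange ℚ_[p]).localTamagawaNumber ℤ_[p]) ∧
        ∃ (N : ℕ) (_ : NeZero N) (D : ModularParametrizationData W N), ¬ (p : ℤ) ∣ D.maninConstant))
    {q₀ : ℚ} (hq₀ : W.entireLFunction 1 / (W.realPeriodRat : ℂ) = (q₀ : ℂ))
    {j : ℕ} (hj : j ≤ padicValNat p W.tamagawaProduct)
    (hw : padicValRat p q₀ - j ≤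
      (padicValNat p (Nat.card (AddCommGroup.primaryComponent W.sha p)) : ℤ)) : BSDp W p :=
  X4RankZero.bsdp_of_facts_of_lower W p hKatoS hDel hGZK hmod hmodD hL20 hKatoχ hr hX hsurj hcov
    (missingLowerBoundAt_of_rankZero_of_LOmegaWitness W p hGZK hmod hr hX.2.2 hq₀ hj hw)

/-- **`p ≥ 5` form**: X4 ∧ `r_an = 0` ∧ surj(p) ∧ [`ord_p j < 0` ∨ (`p ∤ ∏ c_ℓ` ∧ Manin datum)] ∧
the output shape ⟹ `BSD(E,p)` (tower by Serre, local term by Kodaira–Néron). This is where the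
PUBLISHED Kim 2026 Thm. 1.8 (6) delivers the hypothesis (unit-shaped rows: `j = 0`); the census's
11 window rows at `p = 5` already carry such certificates (harvest-2, `X4/KimAdditiveRecordsRankZero.lean`).
[cite: Kato2004Asterisque, Thm. 14.5 (3) (p. 236)] [cite: Serre1972, IV §3.4]
[cite: Miller2011LMS, §1 and Def. 1.1] [cite: Kim2022StructureSelmer, Thm. 1.8 (6) (journal)] -/
theorem X4RankZero.bsdp_of_facts_of_LOmegaWitness_of_five_le
    (hKatoS : Kato2004.rankZero_padicValNat_sha_le_sub_localTamagawa_of_additive_potGood_of_imageContainsSL2)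
    (hDel : Delbourgo1998.prop4_rankZero_pow_dvd_constantCoeff)
    (hGZK : rank_eq_analyticRank_of_analyticRank_le_one) (hmod : hasEntireLFunction_rat)
    (hmodD : nonempty_modularParametrizationData)
    (hL20 : Wuthrich2014.lemma20_surjective_threeAdic_of_semistable)
    (hKatoχ : Wuthrich2014.kato_halfEigenCharIdeal_dvd_cyclotomicPrime_of_surjective)
    (hp5 : 5 ≤ p) (hr : W.analyticRank = 0) (hX : ClassX4 W p) (hsurj : Surj W p)
    (hcov : padicValRat p W.j < 0 ∨
      (¬ p ∣ W.tamagawaProduct ∧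
        ∃ (N : ℕ) (_ : NeZero N) (D : ModularParametrizationData W N), ¬ (p : ℤ) ∣ D.maninConstant))
    {q₀ : ℚ} (hq₀ : W.entireLFunction 1 / (W.realPeriodRat : ℂ) = (q₀ : ℂ))
    {j : ℕ} (hj : j ≤ padicValNat p W.tamagawaProduct)
    (hw : padicValRat p q₀ - j ≤
      (padicValNat p (Nat.card (AddCommGroup.primaryComponent W.sha p)) : ℤ)) : BSDp W p :=
  X4RankZero.bsdp_of_facts_of_LOmegaWitness W p hKatoS hDel hGZK hmod hmodD hL20 hKatoχ hr hX hsurj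
    (hcov.imp_right fun ⟨htam, hD⟩ ↦ ⟨serre_hasSurjectiveModNGaloisRep_pow_holds W p hp5 hsurj,
      (padicValNat_tamagawaProduct_eq_local_iff_not_dvd_of_addv W p hX.2.1 hp5).mpr htam, hD⟩)
    hq₀ hj hw

/-- **`p = 3`, potentially good, fed by kernel certificates** (shape of
`Additive/X4ThreeResCertKernel.lean`): `Addv W 3`, surj(3), the tower `∀ n, ρ̄_{E,3^n}` onto (a
kernel record = Kim 2025's "large image"), `r_an = 0`, `3 ∤ ∏ c_ℓ`, an optimal datum at level
`N ≤ 130000` (Agashe–Ribet–Stein Thm. 2.6, `h26`) and the output shape at `3` ⟹ `BSD(E,3)`. Census: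
the 69 unit-shaped window LOWER rows at `3` (`#Ш_an = 9`, one `= 81`), e.g. `19215t1` — Kim–Pollack's
printed `δ̃_{7·19} ≢ 0 (mod 3)` (arXiv:2505.09121 App. §8.1.1) is such a certificate modulo their
announced Thm. 1.1 (NOT assumed here). [cite: Kato2004Asterisque, Thm. 14.5 (3) (p. 236) and (12.5.2) (p. 222)]
[cite: AgasheRibetStein2006, Thm. 2.6 (p. 619)] [cite: Miller2011LMS, §1 and Def. 1.1] -/
theorem X4RankZero.bsdp_three_of_towerSurj_of_optimal_of_LOmegaWitness
    (hKatoS : Kato2004.rankZero_padicValNat_sha_le_sub_localTamagawa_of_additive_potGood_of_imageContainsSL2)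
    (hDel : Delbourgo1998.prop4_rankZero_pow_dvd_constantCoeff)
    (hGZK : rank_eq_analyticRank_of_analyticRank_le_one) (hmod : hasEntireLFunction_rat)
    (hmodD : nonempty_modularParametrizationData)
    (hL20 : Wuthrich2014.lemma20_surjective_threeAdic_of_semistable)
    (hKatoχ : Wuthrich2014.kato_halfEigenCharIdeal_dvd_cyclotomicPrime_of_surjective)
    (h26 : cremona_abs_maninConstant_eq_one_of_level_le)
    (hadd : haveI : Fact (Nat.Prime 3) := ⟨Nat.prime_three⟩; Addv W 3)
    (hsurj : W.HasSurjectiveModNGaloisRep 3)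
    (htower : ∀ n : ℕ, W.HasSurjectiveModNGaloisRep (3 ^ n : ℕ))
    (hr : W.analyticRank = 0) (htam : ¬ 3 ∣ W.tamagawaProduct)
    {N : ℕ} [NeZero N] (hN : N ≤ 130000)
    (hopt : ∃ D : ModularParametrizationData W N,
      ∀ z ∈ D.L.lattice, ∃ w ∈ periodLattice D.f, z = D.c * w)
    {q₀ : ℚ} (hq₀ : W.entireLFunction 1 / (W.realPeriodRat : ℂ) = (q₀ : ℂ))
    (hw : padicValRat 3 q₀ ≤
      (padicValNat 3 (Nat.card (AddCommGroup.primaryComponent W.sha 3)) : ℤ)) :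
    haveI : Fact (Nat.Prime 3) := ⟨Nat.prime_three⟩
    BSDp W 3 := by
  haveI : Fact (Nat.Prime 3) := ⟨Nat.prime_three⟩
  have hX : ClassX4 W 3 :=
    ⟨by norm_num, hadd, hasIrreducibleModPGaloisRep_of_hasSurjectiveModNGaloisRep W 3 hsurj⟩
  exact X4RankZero.bsdp_of_facts_of_LOmegaWitness W 3 hKatoS hDel hGZK hmod hmodD hL20 hKatoχ hr hX
    hsurj (Or.inr ⟨htower, padicValNat_tamagawaProduct_eq_local_of_not_dvd W 3 htam,
      exists_maninDatum_of_optimal h26 W hN hopt⟩) hq₀ (j := 0) (Nat.zero_le _) (by simpa using hw)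

/-- **`p = 3`, potentially multiplicative (`ord₃ j < 0`)**: X4 ∧ `r_an = 0` ∧ surj(3) ∧ `ord₃ j < 0`
∧ the output shape with `j ≤ ord₃ ∏ c_ℓ` ⟹ `BSD(E,3)` — NO tower, Tamagawa or Manin binder on the
upper half (additive-p1's `ω`-branch route). Census: the 54 (M) window LOWER rows at `3`.
[cite: Delbourgo1998, Prop. 4 (p. 144)] [cite: Wuthrich2014, Lemma 20 (p. 399)]
[cite: Miller2011LMS, §1 and Def. 1.1] -/
theorem X4RankZero.bsdp_three_potMult_of_LOmegaWitness
    (hKatoS : Kato2004.rankZero_padicValNat_sha_le_sub_localTamagawa_of_additive_potGood_of_imageContainsSL2)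
    (hDel : Delbourgo1998.prop4_rankZero_pow_dvd_constantCoeff)
    (hGZK : rank_eq_analyticRank_of_analyticRank_le_one) (hmod : hasEntireLFunction_rat)
    (hmodD : nonempty_modularParametrizationData)
    (hL20 : Wuthrich2014.lemma20_surjective_threeAdic_of_semistable)
    (hKatoχ : Wuthrich2014.kato_halfEigenCharIdeal_dvd_cyclotomicPrime_of_surjective)
    (hr : W.analyticRank = 0) (hX : haveI : Fact (Nat.Prime 3) := ⟨Nat.prime_three⟩; ClassX4 W 3)
    (hsurj : W.HasSurjectiveModNGaloisRep 3) (hjneg : padicValRat 3 W.j < 0)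
    {q₀ : ℚ} (hq₀ : W.entireLFunction 1 / (W.realPeriodRat : ℂ) = (q₀ : ℂ))
    {j : ℕ} (hj : j ≤ padicValNat 3 W.tamagawaProduct)
    (hw : padicValRat 3 q₀ - j ≤
      (padicValNat 3 (Nat.card (AddCommGroup.primaryComponent W.sha 3)) : ℤ)) :
    haveI : Fact (Nat.Prime 3) := ⟨Nat.prime_three⟩
    BSDp W 3 :=
  haveI : Fact (Nat.Prime 3) := ⟨Nat.prime_three⟩
  X4RankZero.bsdp_of_facts_of_LOmegaWitness W 3 hKatoS hDel hGZK hmod hmodD hL20 hKatoχ hr hX hsurj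
    (Or.inl hjneg) hq₀ hj hw

/-! ### §3 The Tamagawa-defect-ONE LOWER rows: sharp Kato + Cassels–Tate parity + the output shape -/

/-- **Parity socket.** X4 ∧ `r_an = 0` ∧ `ord_p j ≥ 0` ∧ `ρ̄_{E,p^n}` onto ∀ `n` ∧ a datum with
`p ∤ c_D` ∧ `ord_p ∏ c_ℓ ≤ v_p(c_p) + 1` ∧ `ord_p #Ш_an` EVEN ∧ the output shape (`j ≤ ord_p ∏ c_ℓ`)
⟹ `BSD(E,p)`: the sharp Kato bound gives `ord_p #Ш ≤ ord_p #Ш_an + 1`, §1 gives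
`ord_p #Ш_an ≤ ord_p #Ш`, Cassels–Tate makes `ord_p #Ш` even, and an even number in
`[ord_p #Ш_an, ord_p #Ш_an + 1]` with `ord_p #Ш_an` even is `ord_p #Ш_an`. Census: the 5 window LOWER
rows at `p = 3` with ONE factor `3` in `∏_{ℓ≠3} c_ℓ` (`#Ш_an = 9`). Per pair; no Kurihara-number
theorem assumed. [cite: Kato2004Asterisque, Thm. 14.5 (3) (p. 236), Prop. 14.16 (2) (p. 244)]
[cite: SilvermanAEC2009, Thm. X.4.14] [cite: Miller2011LMS, §1 and Def. 1.1]
[cite: Kim2022StructureSelmer, Thm. 1.8 (6) (journal)] -/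
theorem X4RankZero.bsdp_of_katoSharp_of_casselsTate_of_LOmegaWitness_of_even
    (hCT : exists_casselsTate_pairing (K := ℚ))
    (hKatoS : Kato2004.rankZero_padicValNat_sha_le_sub_localTamagawa_of_additive_potGood_of_imageContainsSL2)
    (hGZK : rank_eq_analyticRank_of_analyticRank_le_one) (hmod : hasEntireLFunction_rat)
    (hr : W.analyticRank = 0) (hX : ClassX4 W p) (hpot : 0 ≤ padicValRat p W.j)
    (htower : ∀ n : ℕ, W.HasSurjectiveModNGaloisRep (p ^ n : ℕ))
    {N : ℕ} [NeZero N] (D : ModularParametrizationData W N) (hc : ¬ (p : ℤ) ∣ D.maninConstant)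
    (hdef : padicValNat p W.tamagawaProduct ≤
      padicValNat p ((W.baseChange ℚ_[p]).localTamagawaNumber ℤ_[p]) + 1)
    {q : ℚ} (hq : shaAn W = (q : ℂ)) (heven : Even (padicValRat p q))
    {q₀ : ℚ} (hq₀ : W.entireLFunction 1 / (W.realPeriodRat : ℂ) = (q₀ : ℂ))
    {j : ℕ} (hj : j ≤ padicValNat p W.tamagawaProduct)
    (hw : padicValRat p q₀ - j ≤
      (padicValNat p (Nat.card (AddCommGroup.primaryComponent W.sha p)) : ℤ)) : BSDp W p := by
  obtain ⟨hevenSha, q', hq', hup⟩ :=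
    X4RankZero.even_padicValNat_shaOrder_and_le_of_katoSharp W p hCT hKatoS hGZK hmod hr hX hpot
      htower D hc
  have hqq : q' = q := by exact_mod_cast hq'.symm.trans hq
  subst hqq
  obtain ⟨q'', hq'', hlow⟩ :=
    missingLowerBoundAt_of_rankZero_of_LOmegaWitness W p hGZK hmod hr hX.2.2 hq₀ hj hw
  have hqq' : q'' = q' := by exact_mod_cast hq''.symm.trans hq'
  subst hqq'
  have hdef' : (padicValNat p W.tamagawaProduct : ℤ) ≤
      padicValNat p ((W.baseChange ℚ_[p]).localTamagawaNumber ℤ_[p]) + 1 := by exact_mod_cast hdef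
  have heq : padicValRat p q'' = padicValNat p W.shaOrder := by
    obtain ⟨a, ha⟩ := hevenSha
    obtain ⟨b, hb⟩ := heven
    have ha' : (padicValNat p W.shaOrder : ℤ) = a + a := by exact_mod_cast ha
    omega
  exact bsdp_of_missingPPartAt W p hGZK (by rw [hr]; exact zero_le_one) ⟨q'', hq'', heq⟩

/-- **`p = 3` certificate form of the parity socket** (kernel-certificate shape): `Addv W 3`,
surj(3), tower record, `r_an = 0`, `ord₃ j ≥ 0`, an optimal datum at level `N ≤ 130000` (`h26`),
`ord₃ ∏ c_ℓ ≤ v₃(c₃) + 1`, `#Ш_an = q` with `ord₃ q` even, and the output shape at `3` with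
`j ≤ ord₃ ∏ c_ℓ` ⟹ `BSD(E,3)`. Census: `15930u1`-type rows (window: 5 LOWER rows with one `3` among
the `c_ℓ`, `ℓ ≠ 3`). [cite: Kato2004Asterisque, Thm. 14.5 (3) (p. 236)]
[cite: AgasheRibetStein2006, Thm. 2.6 (p. 619)] [cite: SilvermanAEC2009, Thm. X.4.14]
[cite: Miller2011LMS, §1 and Def. 1.1] -/
theorem X4RankZero.bsdp_three_of_towerSurj_of_optimal_of_LOmegaWitness_of_even
    (hCT : exists_casselsTate_pairing (K := ℚ))
    (hKatoS : Kato2004.rankZero_padicValNat_sha_le_sub_localTamagawa_of_additive_potGood_of_imageContainsSL2)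
    (hGZK : rank_eq_analyticRank_of_analyticRank_le_one) (hmod : hasEntireLFunction_rat)
    (h26 : cremona_abs_maninConstant_eq_one_of_level_le)
    (hadd : haveI : Fact (Nat.Prime 3) := ⟨Nat.prime_three⟩; Addv W 3)
    (hsurj : W.HasSurjectiveModNGaloisRep 3)
    (htower : ∀ n : ℕ, W.HasSurjectiveModNGaloisRep (3 ^ n : ℕ))
    (hr : W.analyticRank = 0) (hpot : 0 ≤ padicValRat 3 W.j)
    {N : ℕ} [NeZero N] (hN : N ≤ 130000)
    (hopt : ∃ D : ModularParametrizationData W N,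
      ∀ z ∈ D.L.lattice, ∃ w ∈ periodLattice D.f, z = D.c * w)
    (hdef : haveI : Fact (Nat.Prime 3) := ⟨Nat.prime_three⟩;
      padicValNat 3 W.tamagawaProduct ≤
        padicValNat 3 ((W.baseChange ℚ_[3]).localTamagawaNumber ℤ_[3]) + 1)
    {q : ℚ} (hq : shaAn W = (q : ℂ)) (heven : Even (padicValRat 3 q))
    {q₀ : ℚ} (hq₀ : W.entireLFunction 1 / (W.realPeriodRat : ℂ) = (q₀ : ℂ))
    {j : ℕ} (hj : j ≤ padicValNat 3 W.tamagawaProduct)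
    (hw : padicValRat 3 q₀ - j ≤
      (padicValNat 3 (Nat.card (AddCommGroup.primaryComponent W.sha 3)) : ℤ)) :
    haveI : Fact (Nat.Prime 3) := ⟨Nat.prime_three⟩
    BSDp W 3 := by
  haveI : Fact (Nat.Prime 3) := ⟨Nat.prime_three⟩
  have hX : ClassX4 W 3 :=
    ⟨by norm_num, hadd, hasIrreducibleModPGaloisRep_of_hasSurjectiveModNGaloisRep W 3 hsurj⟩
  obtain ⟨N', hN', D, hD⟩ := exists_maninDatum_of_optimal h26 W hN hopt
  haveI : NeZero N' := hN'
  exact X4RankZero.bsdp_of_katoSharp_of_casselsTate_of_LOmegaWitness_of_even W 3 hCT hKatoS hGZK hmod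
    hr hX hpot htower D hD hdef hq heven hq₀ hj hw

end Summit.BirchSwinnertonDyer.Rank1Residual.Additive

end
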